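import Literature.MathematicalPhysics.QuantumFieldTheory.Balaban1983to89.Beta.LimitRate
import Literature.MathematicalPhysics.QuantumFieldTheory.Balaban1983to89.Beta.InfiniteVolume

/-!
# `BalabanUV.Beta.GAN24.DiagramDecayZdSocket` — binder row G-an2-4 ∕ (CONV-C), route R7 «TWO CURRENCIES», PART 133: THE `ℤ^d` SOCKET.  Volume-uniform torus bounds of (CONV-C)'s two-clause
# shape — (UD) `|P^{(k)}_t(x)| ≤ C·e^{−δ|x|₁}` and (SR) `|P^{(k+1)}_t(x) − P^{(k)}_t(x)| ≤ C′θ^k·e^{−δ′|x|₁}` in the WINDOW coordinates of the torus of side `side t`, constants free of the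
# scale `k` AND of the volume `t` (the currency PARTs 115–132 produce, on every torus, for the model's constituents and their diagrams) — together with the EXISTENCE of the
# infinite-volume limits `P^{(k)}_t → Π_k` at each fixed scale (the β-cell's `IsInfiniteVolumeLimit`, (1.21) p. 264; a displayed HYPOTHESIS here) give, on `ℤ^d`, EXACTLY the two
# kernel-level inputs of the β-cell's `Beta.LimitRate`: `UniformDecay Π μ ν C δ` and the one-step rate `StepRate Π μ ν C′ δ′ θ`; hence `KernelInputs d Π` (`KernelInputs.ofStepRate`) and
# `|β⁰_{k+1} − β⁰_∞| ≤ c₀θ^k` with `c₀ = β′_d(C′∕(1−θ), δ′)` — the `hconv` field of `Beta.Assembly.LimitForm` — for the (1.22) second moments of the limit kernels.  Closed inequalities pass to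
# pointwise limits; nothing else is used (unit b2b-balaban-gan24-p3, gen 53; v1)

NOT IN PRINT; OUR PROOF ([folklore] `le_of_tendsto` BY NAME over the β-cell's `Beta.InfiniteVolume` (`windowKernel`, `windowMap`, `tendsto_windowKernel`, `decay510_of_isInfiniteVolumeLimit`,
`tendsto_torusSecondMoment`, `UniformDecay`) and `Beta.LimitRate` (`StepRate`, `UniformDecay`, `KernelInputs.ofStepRate`, `abs_sub_binf_le`, `limKernelOf`); [Balaban1987RG1] (1.21)–(1.22)
p. 264 and (5.10) p. 293 locate the SHAPES (quoted in those modules); nothing printed is a hypothesis of a theorem here except as the displayed `IsInfiniteVolumeLimit` ∕ bounds).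
HONEST FRAMING (cell contract, verbatim): «discharging `BetaPertH` makes Bałaban's UV stability UNCONDITIONAL — a real constructive-QFT result; it is NOT the
continuum limit and NOT the Clay problem.»  HONEST DEPENDENCY (verbatim): «continuum YM on T⁴ ⇐ BetaPertH ∧ nine spine estimates (0/9 proved); BetaPertH ⇐
(D1) ∧ (D4) ∧ CAP+tail; G-an2-4 gates asym, D1 and NE2/3/4.»

WHY THIS FILE.  g52's successor note (verbatim): «the passage finite torus → ℤ^d (road P2's de-periodisation; the volume-free constants here are the input that passage needs)».  The
β-cell's consumer of (CONV-C) is `KernelInputs` ON `ℤ^d`; the lineage's theorems live on finite tori with constants free of the volume.  This file records, in the β-cell's OWN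
carriers (`Site d (side t)`, `windowMap`, `IsInfiniteVolumeLimit`, `B12Beta.Kernel`), that volume-freeness is exactly what the passage consumes: given the limits, BOTH clauses transfer
verbatim, and the β-cell's constructor does the rest.  What it leaves displayed is the ONE analytic input the lineage does not produce: the existence of the `t → ∞` limit of the torus
kernels at fixed scale (for block-periodic inverses the β-cell's `EntrywiseVolumeLimit` is the located tool; not invoked here).

WHAT THIS FILE PROVES (0 sorry, 0 `def`; `P : ℕ → (t : ℕ) → Fin d → Fin d → Site d (side t) → ℝ` the torus kernels per scale `k` and volume `t`, `Π : ℕ → B12Beta.Kernel d` the limits):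
* §1 `abs_windowKernel_sub_le` (a volume-uniform window bound on a difference of torus kernels is a bound on the difference of their window kernels, all `y ∈ ℤ^d`);
  **`stepRate_of_isInfiniteVolumeLimit`** — `side t → ∞`, `∀ k, IsInfiniteVolumeLimit side (P k) (Π k)`, (SR)_vol `∀ k t x, |P (k+1) t μ ν x − P k t μ ν x| ≤ C′θ^k e^{−δ′|windowMap x|₁}` ⟹
  `LimitRate.StepRate Π μ ν C′ δ′ θ`; **`uniformDecay_of_isInfiniteVolumeLimit`** — (UD)_vol `∀ k, InfiniteVolume.UniformDecay side (P k) C δ` ⟹ `LimitRate.UniformDecay Π μ ν C δ`.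
* §2 **`exists_kernelInputs_of_volumeUniform`** — with `μ ≠ ν`, `δ, δ′ > 0`, `0 ≤ θ < 1`: `∃ K : KernelInputs d Π` with `K.θ = θ`, `K.c₀ = β′_d(C′∕(1−θ), δ′)`, `K.Pinf = limKernelOf Π`;
  **`abs_secondMoment_sub_le_of_volumeUniform`** — THE (AF-0r) CLAUSE ON `ℤ^d`: `∀ k, |secondMoment (Π k) μ ν − secondMoment (limKernelOf Π) μ ν| ≤ β′_d(C′∕(1−θ), δ′)·θ^k`.
* §3 **`tendsto_torusSecondMoment_scale`** — and the torus β-numbers converge to the `ℤ^d` ones at each scale: `torusSecondMoment (P k t) μ ν → secondMoment (Π k) μ ν` (`t → ∞`) — so the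
  volume-uniform torus β-shadows of PART 132 and the (1.22) functional of the limit kernel are the two ends of one double limit.
WHAT IT DOES NOT DO: produce `IsInfiniteVolumeLimit` for any kernel (HYPOTHESIS); identify `Π` with Bałaban's `Π⁰_{k+1}` (row an1's dictionary ∕ `OneLoopDictionary`); read the lineage's
`distK`-currency on `idx L M 0` into window coordinates (PART 134: `|windowMap x|₁ ≤ d·tdist(x,0)` on cubic tori).  SUPPLIER work; no consumer of record; NEVER «G-an2-4 closed»; NOT
(CONV-C), NOT D1, NOT `BetaPertH`, NOT continuum, NOT Clay.  Records: `HOME/b2b-balaban-gan24-p3/gen53/README.md`.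
-/

noncomputable section

open Filter Topology

namespace Summit.QuantumFields.BalabanUV.Beta.GAN24.DiagramDecayZdSocket

open Literature.MathematicalPhysics.QuantumFieldTheory.Balaban1983to89
open Literature.MathematicalPhysics.QuantumFieldTheory.Balaban1983to89.B12Sec2to5 (l1 Decay510 betaPrime510)
open Literature.MathematicalPhysics.QuantumFieldTheory.Balaban1983to89.Beta
  (Site windowMap windowExt windowKernel siteOf InWindow IsInfiniteVolumeLimit torusSecondMoment
   windowExt_of_inWindow windowExt_of_not_inWindow windowMap_siteOf tendsto_windowKernel decay510_of_isInfiniteVolumeLimit tendsto_torusSecondMoment)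
open Literature.MathematicalPhysics.QuantumFieldTheory.Balaban1983to89.Beta.LimitRate (StepRate subKernel subKernel_apply limKernelOf KernelInputs)

variable {d : ℕ} {side : ℕ → ℕ} [∀ t, NeZero (side t)]
  {P : ℕ → (t : ℕ) → Fin d → Fin d → Site d (side t) → ℝ} {Pinf : ℕ → B12Beta.Kernel d}

/-! ## §1 Both clauses pass to the infinite-volume limit -/

omit [∀ t, NeZero (side t)] in
/-- a volume-uniform bound `|F x − G x| ≤ A·e^{−δ′|windowMap x|₁}` on a torus passes to the window kernels at EVERY `y ∈ ℤ^d` (on the window the window coordinates of `siteOf y` are `y`;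
off the window both window kernels vanish and `A ≥ 0`). [folklore] -/
theorem abs_windowKernel_sub_le {s : ℕ} [NeZero s] {F G : Fin d → Fin d → Site d s → ℝ} {μ ν : Fin d} {A δ' : ℝ} (hA : 0 ≤ A)
    (h : ∀ x : Site d s, |F μ ν x - G μ ν x| ≤ A * Real.exp (-δ' * l1 (windowMap d s x))) (y : Fin d → ℤ) :
    |windowKernel F μ ν y - windowKernel G μ ν y| ≤ A * Real.exp (-δ' * l1 y) := by
  unfold windowKernel
  by_cases hy : ∀ i, InWindow s (y i)
  · rw [windowExt_of_inWindow _ hy, windowExt_of_inWindow _ hy]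
    have := h (siteOf d s y)
    rwa [windowMap_siteOf d s hy] at this
  · rw [windowExt_of_not_inWindow _ hy, windowExt_of_not_inWindow _ hy, sub_zero, abs_zero]
    positivity

/-- **`stepRate_of_isInfiniteVolumeLimit` — (SR) PASSES TO `ℤ^d`** [folklore]: torus sides `side t → ∞`, the infinite-volume limits `P^{(k)}_t → Π_k` at every scale (the β-cell's
`IsInfiniteVolumeLimit`, HYPOTHESIS), and the VOLUME-UNIFORM one-step bound `|P^{(k+1)}_t(x) − P^{(k)}_t(x)| ≤ C′θ^k·e^{−δ′|windowMap x|₁}` for all `k, t, x` ⟹ the β-cell's (PR′)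
`StepRate Π μ ν C′ δ′ θ` on `ℤ^d` (the differences of the window kernels converge to `Π_{k+1} − Π_k` pointwise; closed inequalities pass to the limit). [cite: Balaban1987RG1, (1.21) p.264] -/
theorem stepRate_of_isInfiniteVolumeLimit (hside : Tendsto side atTop atTop) (hlim : ∀ k, IsInfiniteVolumeLimit side (P k) (Pinf k)) {μ ν : Fin d} {C' δ' θ : ℝ}
    (hstep : ∀ k t (x : Site d (side t)), |P (k + 1) t μ ν x - P k t μ ν x| ≤ C' * θ ^ k * Real.exp (-δ' * l1 (windowMap d (side t) x))) :
    StepRate Pinf μ ν C' δ' θ := by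
  intro k y
  rw [subKernel_apply]
  have hA : 0 ≤ C' * θ ^ k := by
    have h := hstep k 0 (siteOf d (side 0) 0)
    exact nonneg_of_mul_nonneg_left ((abs_nonneg _).trans h) (Real.exp_pos _)
  have hconv : Tendsto (fun t => windowKernel (P (k + 1) t) μ ν y - windowKernel (P k t) μ ν y) atTop (𝓝 (Pinf (k + 1) μ ν y - Pinf k μ ν y)) :=
    (tendsto_windowKernel hside (hlim (k + 1)) μ ν y).sub (tendsto_windowKernel hside (hlim k) μ ν y)
  exact le_of_tendsto' hconv.abs fun t => abs_windowKernel_sub_le hA (hstep k t) y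

/-- **`uniformDecay_of_isInfiniteVolumeLimit` — (UD) PASSES TO `ℤ^d`** [folklore]: the β-cell's volume-uniform torus decay `InfiniteVolume.UniformDecay side (P k) C δ` at every scale with the
SAME `(C, δ)` and the limits ⟹ `LimitRate.UniformDecay Π μ ν C δ` (`decay510_of_isInfiniteVolumeLimit` per scale). [cite: Balaban1987RG1, (5.10) p.293 (shape)] -/
theorem uniformDecay_of_isInfiniteVolumeLimit (hside : Tendsto side atTop atTop) (hlim : ∀ k, IsInfiniteVolumeLimit side (P k) (Pinf k)) {C δ : ℝ}
    (hdec : ∀ k, Beta.UniformDecay side (P k) C δ) (μ ν : Fin d) : Beta.LimitRate.UniformDecay Pinf μ ν C δ :=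
  fun k => decay510_of_isInfiniteVolumeLimit hside (hlim k) (hdec k) μ ν

/-! ## §2 The β-cell's `KernelInputs` and the (AF-0r) clause on `ℤ^d` -/

/-- **`exists_kernelInputs_of_volumeUniform` — VOLUME-UNIFORM TWO-CLAUSE TORUS BOUNDS + INFINITE-VOLUME LIMITS ⟹ THE β-CELL's `KernelInputs`** [folklore]: with `μ ≠ ν`, `δ, δ′ > 0`,
`0 ≤ θ < 1`, the hypotheses of §1 give `K : KernelInputs d Π` (by `KernelInputs.ofStepRate`) with rate `K.θ = θ`, constant `K.c₀ = β′_d(C′∕(1−θ), δ′)` and limit kernel `K.Pinf = limKernelOf Π`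
(the telescoped `η → 0` limit).  Nothing about Bałaban's kernels is asserted: `P`, `Π` are whatever satisfies the displayed hypotheses. [cite: Balaban1987RG1, (1.22) p.264] -/
theorem exists_kernelInputs_of_volumeUniform (hside : Tendsto side atTop atTop) (hlim : ∀ k, IsInfiniteVolumeLimit side (P k) (Pinf k)) {μ ν : Fin d} (hne : μ ≠ ν)
    {C δ C' δ' θ : ℝ} (hδ : 0 < δ) (hδ' : 0 < δ') (hθ0 : 0 ≤ θ) (hθ1 : θ < 1) (hdec : ∀ k, Beta.UniformDecay side (P k) C δ)
    (hstep : ∀ k t (x : Site d (side t)), |P (k + 1) t μ ν x - P k t μ ν x| ≤ C' * θ ^ k * Real.exp (-δ' * l1 (windowMap d (side t) x))) :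
    ∃ K : KernelInputs d Pinf, K.θ = θ ∧ K.c₀ = betaPrime510 d (C' / (1 - θ)) δ' ∧ K.Pinf = limKernelOf Pinf ∧ K.μ = μ ∧ K.ν = ν :=
  ⟨KernelInputs.ofStepRate hne hδ (uniformDecay_of_isInfiniteVolumeLimit hside hlim hdec μ ν) hδ' hθ0 hθ1 (stepRate_of_isInfiniteVolumeLimit hside hlim hstep),
    rfl, rfl, rfl, rfl, rfl⟩

/-- **`abs_secondMoment_sub_le_of_volumeUniform` — THE (AF-0r) CLAUSE `|β⁰_{k+1} − β⁰_∞| ≤ c₀θ^k` ON `ℤ^d` FROM VOLUME-UNIFORM TORUS DATA** [folklore]: under the hypotheses of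
`exists_kernelInputs_of_volumeUniform`, the (1.22) second moments of the limit kernels satisfy `|secondMoment (Π k) μ ν − secondMoment (limKernelOf Π) μ ν| ≤ β′_d(C′∕(1−θ), δ′)·θ^k` for
every `k` — LITERALLY the field `conv` of `Beta.Assembly.LimitForm` for the sequence `k ↦ secondMoment (Π k) μ ν` with `binf = secondMoment (limKernelOf Π) μ ν`, `c₀ = β′_d(C′∕(1−θ), δ′)`.
[cite: Balaban1987RG1, (1.22) p.264] -/
theorem abs_secondMoment_sub_le_of_volumeUniform (hside : Tendsto side atTop atTop) (hlim : ∀ k, IsInfiniteVolumeLimit side (P k) (Pinf k)) {μ ν : Fin d} (hne : μ ≠ ν)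
    {C δ C' δ' θ : ℝ} (hδ : 0 < δ) (hδ' : 0 < δ') (hθ0 : 0 ≤ θ) (hθ1 : θ < 1) (hdec : ∀ k, Beta.UniformDecay side (P k) C δ)
    (hstep : ∀ k t (x : Site d (side t)), |P (k + 1) t μ ν x - P k t μ ν x| ≤ C' * θ ^ k * Real.exp (-δ' * l1 (windowMap d (side t) x))) (k : ℕ) :
    |B12Beta.secondMoment (Pinf k) μ ν - B12Beta.secondMoment (limKernelOf Pinf) μ ν| ≤ betaPrime510 d (C' / (1 - θ)) δ' * θ ^ k :=
  (KernelInputs.ofStepRate hne hδ (uniformDecay_of_isInfiniteVolumeLimit hside hlim hdec μ ν) hδ' hθ0 hθ1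
    (stepRate_of_isInfiniteVolumeLimit hside hlim hstep)).abs_sub_binf_le k

/-! ## §3 The torus β-numbers converge to the `ℤ^d` ones at each scale -/

/-- **`tendsto_torusSecondMoment_scale`** [folklore]: under `side t → ∞`, the limits and the volume-uniform decay (UD)_vol with `δ > 0`, at every scale `k` the torus second moments converge to the
(1.22) functional of the limit kernel: `torusSecondMoment (P k t) μ ν → secondMoment (Π k) μ ν` — the β-cell's `tendsto_torusSecondMoment` per scale; with §2 the volume-uniform torus β-shadows
(PART 132) and `|β⁰_{k+1} − β⁰_∞| ≤ c₀θ^k` on `ℤ^d` are the two ends of ONE double limit `t → ∞` then `k → ∞`. [cite: Balaban1987RG1, (1.21)–(1.22) p.264] -/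
theorem tendsto_torusSecondMoment_scale (hside : Tendsto side atTop atTop) (hlim : ∀ k, IsInfiniteVolumeLimit side (P k) (Pinf k)) {C δ : ℝ} (hδ : 0 < δ)
    (hdec : ∀ k, Beta.UniformDecay side (P k) C δ) (k : ℕ) (μ ν : Fin d) :
    Tendsto (fun t => torusSecondMoment (P k t) μ ν) atTop (𝓝 (B12Beta.secondMoment (Pinf k) μ ν)) :=
  tendsto_torusSecondMoment hside (hlim k) hδ (hdec k) μ ν

/-- … hence a bound `|torusSecondMoment (P (k+1) t) − torusSecondMoment (P k t)| ≤ c·θ^k` valid on ALL sufficiently large tori (the volume-uniform torus β-shadow clause) passes to the `ℤ^d`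
second moments: `|secondMoment (Π (k+1)) − secondMoment (Π k)| ≤ c·θ^k`. [folklore] -/
theorem abs_secondMoment_step_le_of_eventually (hside : Tendsto side atTop atTop) (hlim : ∀ k, IsInfiniteVolumeLimit side (P k) (Pinf k)) {C δ : ℝ} (hδ : 0 < δ)
    (hdec : ∀ k, Beta.UniformDecay side (P k) C δ) {μ ν : Fin d} {c θ : ℝ} (k : ℕ)
    (h : ∀ᶠ t in atTop, |torusSecondMoment (P (k + 1) t) μ ν - torusSecondMoment (P k t) μ ν| ≤ c * θ ^ k) :
    |B12Beta.secondMoment (Pinf (k + 1)) μ ν - B12Beta.secondMoment (Pinf k) μ ν| ≤ c * θ ^ k :=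
  le_of_tendsto ((tendsto_torusSecondMoment_scale hside hlim hδ hdec (k + 1) μ ν).sub (tendsto_torusSecondMoment_scale hside hlim hδ hdec k μ ν)).abs h

end Summit.QuantumFields.BalabanUV.Beta.GAN24.DiagramDecayZdSocket

end
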